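import Summits.KontsevichZagierPeriods.KontsevichZagierPeriods.Theorems.LinRedNormalFormArrangementNormalFormStubRebaseSimpleZeroProductMoves

/-!
# Stub `stub_rebaseSimpleZero`, part `rebaseSimpleZero_product` (crux `ArrangementNormalForm`, line `janus-bands`, v6.2) — `Wedge`

The analytic heart of the rebase of PRODUCT fibres over a one-dimensional base: ABSOLUTE
CONVERGENCE of the literal integrand on a Janus WEDGE of one fibre `i` in the presence of
spectator fibres (`RebaseZero.integrableOn_wedge`), and the two Janus extensions of the fibre `i`
up / down to a level parallel to its letter (`RebaseZero.janus_up`, `RebaseZero.janus_down`,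
instances of `RebasePos.janusExtendHi/Lo`). The wedge argument is that of `stub_rebaseOne`,
pointwise in the base and the spectators: the integrand is `F · 1/(tᵢ − c(y))` with `F` free of
`tᵢ`; `F` is integrable on `D` by domination (`|tᵢ − c| ≤ K` on the bounded `D`), hence on the
image of `D` under the fibrewise affine map `tᵢ ↦ P(y) + λ (tᵢ − Uᵢ(y))` (transport of
integrability, rule 2), which contains the wedge as soon as the wedge fibres are at most `λ` times
as long as those of `D`; and `1/(tᵢ − c) ≤ 1/m` on the wedge. Registered:
`rebaseSimpleZeroProduct_wedge`.

References: M. Kontsevich, D. Zagier, *Periods* (2001), §1.2, rules (1), (2).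
-/

noncomputable section

open Set MeasureTheory MvPolynomial
open Literature.NumberTheory.Transcendental Literature.ModelTheory.ExponentialFields

namespace Summit.KontsevichZagierPeriods.ArrangementNormalForm.JanusBands

namespace RebaseZero

open SeparatePos RebasePos

variable {k : ℕ}

/-! ### The literal integrand and one fibre -/

/-- The literal integrand only sees the base coordinates and the lettered fibres. [folklore] -/
theorem glit_congr (T : BData) (p : MvPolynomial (Fin 0) ℚ) (a : Fin k → Option Cf)
    {z z' : Fin (0 + 1 + k) → ℝ} (hb : ∀ j', z' (Fin.castAdd k j') = z (Fin.castAdd k j'))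
    (hf : ∀ j, a j ≠ none → z' (Fin.natAdd (0 + 1) j) = z (Fin.natAdd (0 + 1) j)) :
    glitB T p a z' = glitB T p a z := by
  simp only [glitB, glit, hb]
  congr 1
  refine Finset.prod_congr rfl fun j _ => ?_
  rcases ha : a j with _ | c
  · rfl
  · simp only [Option.elim_some, hf j (by simp [ha])]

/-- Splitting off the letter of the fibre `i`: `glit a = glit a[i ↦ none] · 1/(tᵢ − c(y))`. [folklore] -/
theorem glit_split (T : BData) (p : MvPolynomial (Fin 0) ℚ) (a : Fin k → Option Cf) (i : Fin k)
    (c : Cf) (ha : a i = some c) (z : Fin (0 + 1 + k) → ℝ) :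
    glitB T p a z = glitB T p (Function.update a i none) z * (1 / (tv z i - ev c (yv z))) := by
  have key : fib 0 k a z = fib 0 k (Function.update a i none) z * (1 / (tv z i - ev c (yv z))) := by
    set g : Fin k → Option Cf → ℝ := fun j o => o.elim (1 : ℝ) (fun c => 1 / (z (Fin.natAdd (0 + 1) j) -
      (∑ i', (c.1 i' : ℝ) * z (Fin.castAdd k i') + (c.2 : ℝ)))) with hg
    have h1 : fib 0 k a z = ∏ j, g j (a j) := rfl
    have h2 : fib 0 k (Function.update a i none) z = ∏ j, g j (Function.update a i none j) := rfl
    rw [h1, h2, ← Finset.mul_prod_erase Finset.univ (fun j => g j (a j)) (Finset.mem_univ i),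
      ← Finset.mul_prod_erase Finset.univ (fun j => g j (Function.update a i none j)) (Finset.mem_univ i)]
    have h3 : ∏ j ∈ Finset.univ.erase i, g j (Function.update a i none j) =
        ∏ j ∈ Finset.univ.erase i, g j (a j) :=
      Finset.prod_congr rfl fun j hj => by rw [Function.update_of_ne (Finset.ne_of_mem_erase hj)]
    rw [h3, ha, Function.update_self]
    simp only [hg, Option.elim_some, Option.elim_none, one_mul, sum_eq]
    exact mul_comm _ _
  simp only [glitB, glit_eq] at key ⊢
  rw [key]
  ring

/-! ### The fibrewise affine map -/

/-- `fibAff` on the moved coordinate. [folklore] -/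
theorem fibAff_self (i : Fin k) (β l ν : ℝ) (z : Fin (0 + 1 + k) → ℝ) :
    tv (fibAff i β l ν z) i = β * yv z + l * tv z i + ν := by
  simp only [tv, fibAff, Pi.add_apply, Pi.smul_apply, Pi.single_eq_same, smul_eq_mul, mul_one]
  simp only [yv]; ring

/-- `fibAff` fixes the other coordinates. [folklore] -/
theorem fibAff_of_ne (i : Fin k) (β l ν : ℝ) (z : Fin (0 + 1 + k) → ℝ) {j : Fin (0 + 1 + k)}
    (hj : j ≠ tIdx i) : fibAff i β l ν z j = z j := by
  simp only [fibAff, Pi.add_apply, Pi.smul_apply, Pi.single_eq_of_ne hj, smul_zero, add_zero]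

/-- `fibAff` fixes the base coordinate. [folklore] -/
@[simp] theorem yv_fibAff (i : Fin k) (β l ν : ℝ) (z : Fin (0 + 1 + k) → ℝ) :
    yv (fibAff i β l ν z) = yv z :=
  fibAff_of_ne i β l ν z (yIdx_ne_tIdx i)

/-- `fibAff` fixes the spectator fibres. [folklore] -/
theorem tv_fibAff_of_ne (i : Fin k) (β l ν : ℝ) (z : Fin (0 + 1 + k) → ℝ) {j : Fin k} (hj : j ≠ i) :
    tv (fibAff i β l ν z) j = tv z j :=
  fibAff_of_ne i β l ν z (tIdx_injective.ne hj)

/-- The derivative of `fibAff`. [folklore] -/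
theorem hasFDerivAt_fibAff (i : Fin k) (β l ν : ℝ) (z : Fin (0 + 1 + k) → ℝ) :
    HasFDerivAt (fibAff i β l ν) (fibAffL i β l) z := by
  have hφ : HasFDerivAt (fun z : Fin (0 + 1 + k) → ℝ => β * yv z + (l - 1) * tv z i + ν)
      (β • (ContinuousLinearMap.proj (R := ℝ) (φ := fun _ : Fin (0 + 1 + k) => ℝ) (yIdx k)) +
        (l - 1) • (ContinuousLinearMap.proj (R := ℝ) (φ := fun _ : Fin (0 + 1 + k) => ℝ) (tIdx i))) z := by
    have h1 : HasFDerivAt (fun z : Fin (0 + 1 + k) → ℝ => z (yIdx k))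
        (ContinuousLinearMap.proj (R := ℝ) (φ := fun _ : Fin (0 + 1 + k) => ℝ) (yIdx k)) z :=
      hasFDerivAt_apply (yIdx k) z
    have h2 : HasFDerivAt (fun z : Fin (0 + 1 + k) → ℝ => z (tIdx i))
        (ContinuousLinearMap.proj (R := ℝ) (φ := fun _ : Fin (0 + 1 + k) => ℝ) (tIdx i)) z :=
      hasFDerivAt_apply (tIdx i) z
    exact ((h1.const_mul β).add (h2.const_mul (l - 1))).add_const ν
  exact (hasFDerivAt_id z).add (hφ.smul_const (Pi.single (tIdx i) (1 : ℝ) : Fin (0 + 1 + k) → ℝ))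

/-- `fibAff` is injective when `l ≠ 0`. [folklore] -/
theorem fibAff_injective (i : Fin k) (β ν : ℝ) {l : ℝ} (hl : l ≠ 0) :
    Function.Injective (fibAff i β l ν) := by
  intro z w h
  have hne : ∀ j, j ≠ tIdx i → z j = w j := fun j hj => by
    rw [← fibAff_of_ne i β l ν z hj, h, fibAff_of_ne i β l ν w hj]
  have hy : yv z = yv w := hne _ (yIdx_ne_tIdx i)
  have ht : tv z i = tv w i := by
    have h' := congrArg (fun x => tv x i) h
    simp only [fibAff_self, hy] at h'
    exact mul_left_cancel₀ hl (by linarith)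
  funext j
  by_cases hj : j = tIdx i
  · rw [hj]; exact ht
  · exact hne j hj

/-! ### The wedge -/

/-- **Absolute convergence on a wedge.** Let the product representation `s` (domain
`D = {… Uᵢ < tᵢ < Vᵢ …}`) carry the letter `c` on the fibre `i`. If the wedge
`W = {… P < tᵢ < Q …}` (same base cell, same spectators) stays at distance `≥ m > 0` above the
letter and its `tᵢ`-fibres are at most `λ` times as long as those of `D`, then the literal
integrand converges absolutely on `W`. -/
theorem integrableOn_wedge {s : KZ.IntegralRep (0 + 1 + k)} {m' : ℕ} {M : Fin m' → Cf}
    {U V : Fin k → Cf} {T : BData} {p : MvPolynomial (Fin 0) ℚ} {a : Fin k → Option Cf}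
    (h : IsProd s M U V T p a) (i : Fin k) (c : Cf) (ha : a i = some c) (P Q : Cf) (lam mlo : ℝ)
    (hlam : 0 < lam) (hPQ : ∀ y ∈ cell M, 0 < mlo ∧ mlo ≤ ev P y - ev c y ∧
      ev Q y - ev P y ≤ lam * (ev (V i) y - ev (U i) y)) :
    IntegrableOn (glitB T p a) (pDom M (Function.update U i P) (Function.update V i Q)) := by
  set W := pDom M (Function.update U i P) (Function.update V i Q) with hWdef
  set f := glitB T p a with hf
  set F := glitB T p (Function.update a i none) with hF
  have hDm : MeasurableSet s.domain := KZ.IntegralRep.measurableSet_domain_holds s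
  have hWm : MeasurableSet W := measurableSet_pDom _ _ _
  obtain ⟨R, hR⟩ := h.cbd
  have hfF : ∀ z, f z = F z * (1 / (tv z i - ev c (yv z))) := glit_split T p a i c ha
  have hmemW : ∀ z, z ∈ W ↔ yv z ∈ cell M ∧ (ev P (yv z) < tv z i ∧ tv z i < ev Q (yv z)) ∧
      ∀ j, j ≠ i → ev (U j) (yv z) < tv z j ∧ tv z j < ev (V j) (yv z) := fun z => by
    rw [hWdef, mem_pDom]
    refine and_congr_right fun _ => ⟨fun h' => ⟨by simpa using h' i, fun j hj => by
      simpa [Function.update_of_ne hj] using h' j⟩, fun h' j => ?_⟩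
    by_cases hj : j = i
    · subst hj; simpa using h'.1
    · simpa [Function.update_of_ne hj] using h'.2 j hj
  -- (1) `F` is integrable on `D`
  have hfD : IntegrableOn f s.domain := s.integrableOn.congr_fun h.int hDm
  set Kc : ℝ := ((|((U i).1 (Fin.last 0) : ℝ)| + |((V i).1 (Fin.last 0) : ℝ)|) * R +
    (|((U i).2 : ℝ)| + |((V i).2 : ℝ)|)) + (|(c.1 (Fin.last 0) : ℝ)| * R + |(c.2 : ℝ)|) with hKc
  have hFD : IntegrableOn F s.domain := by
    refine Integrable.mono' (hfD.norm.const_mul Kc) (KZ.aestronglyMeasurable_of_isSemialgebraicFunOn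
      (isSemialgebraicFunOn_glit s.isSemialgebraic_domain _ _ _ _ _ _ _ _) hDm) ?_
    filter_upwards [ae_restrict_mem hDm,
      ae_restrict_of_ae (measure_eq_zero_iff_ae_notMem.1 (volume_tv_eq_ev i c))] with z hz hzN
    have hd : tv z i - ev c (yv z) ≠ 0 := sub_ne_zero.2 hzN
    have hdle : |tv z i - ev c (yv z)| ≤ Kc := by
      rw [h.dom] at hz
      obtain ⟨hy, ht⟩ := abs_le_of_mem_pDom M U V hR hz
      calc |tv z i - ev c (yv z)| ≤ |tv z i| + |ev c (yv z)| := abs_sub _ _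
        _ ≤ Kc := add_le_add (ht i) (abs_ev_le_of c hy)
    rw [Real.norm_eq_abs, Real.norm_eq_abs]
    have hfz : f z * (tv z i - ev c (yv z)) = F z := by rw [hfF z]; field_simp
    rw [← hfz, abs_mul, mul_comm]
    exact mul_le_mul_of_nonneg_right hdle (abs_nonneg _)
  -- (2) transport through `ψ : tᵢ ↦ P(y) + λ (tᵢ − Uᵢ(y))`
  set β : ℝ := ((P.1 (Fin.last 0) : ℝ) - lam * (U i).1 (Fin.last 0)) with hβ
  set ν : ℝ := ((P.2 : ℝ) - lam * (U i).2) with hν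
  set ψ := fibAff i β lam ν with hψ
  have hψi : ∀ z, tv (fibAff i β lam ν z) i = ev P (yv z) + lam * (tv z i - ev (U i) (yv z)) :=
    fun z => by rw [fibAff_self, hβ, hν]; simp only [ev]; ring
  have hFψ : ∀ z, F (fibAff i β lam ν z) = F z := fun z =>
    glit_congr T p _ (fun j' => fibAff_of_ne i β lam ν z (IntegrateOutLow.castAdd_ne_natAdd j' i))
      fun j hj => fibAff_of_ne i β lam ν z (tIdx_injective.ne fun hji => hj (by subst hji; simp))
  have hψD : IntegrableOn F (ψ '' s.domain) := by
    rw [integrableOn_image_iff_integrableOn_abs_det_fderiv_smul volume hDm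
      (fun z _ => (hasFDerivAt_fibAff i β lam ν z).hasFDerivWithinAt)
      (fibAff_injective i β ν hlam.ne').injOn]
    simp only [smul_eq_mul, hFψ]
    exact hFD.const_mul _
  -- (3) the wedge lies in `ψ '' D`
  have hWsub : W ⊆ ψ '' s.domain := by
    intro z hz
    obtain ⟨hy, ⟨h1, h2⟩, hrest⟩ := (hmemW z).1 hz
    obtain ⟨-, -, hlen⟩ := hPQ _ hy
    set w := fibAff i (((U i).1 (Fin.last 0) : ℝ) - (P.1 (Fin.last 0) : ℝ) / lam) lam⁻¹
      (((U i).2 : ℝ) - (P.2 : ℝ) / lam) z with hw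
    have hwi : tv w i = ev (U i) (yv z) + (tv z i - ev P (yv z)) / lam := by
      rw [hw, fibAff_self]; simp only [ev]; field_simp; ring
    have hwy : yv w = yv z := yv_fibAff _ _ _ _ _
    refine ⟨w, ?_, ?_⟩
    · rw [h.dom, mem_pDom, hwy]
      refine ⟨hy, fun j => ?_⟩
      by_cases hj : j = i
      · subst hj
        rw [hwi]
        refine ⟨lt_add_of_pos_right _ (div_pos (by linarith) hlam), ?_⟩
        have : (tv z j - ev P (yv z)) / lam < ev (V j) (yv z) - ev (U j) (yv z) := by
          rw [div_lt_iff₀ hlam]; linarith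
        linarith
      · rw [hw, tv_fibAff_of_ne _ _ _ _ _ hj]
        exact hrest j hj
    · funext l
      by_cases hl : l = tIdx i
      · rw [hl]
        show tv (ψ w) i = tv z i
        rw [hψi, hwy, hwi]; field_simp; ring
      · rw [hψ, fibAff_of_ne _ _ _ _ _ hl, hw, fibAff_of_ne _ _ _ _ _ hl]
  have hFW : IntegrableOn F W := hψD.mono_set hWsub
  -- (4) `1/(tᵢ − c) ≤ 1/m` on the wedge
  refine Integrable.mono' (hFW.norm.const_mul (1 / mlo)) (KZ.aestronglyMeasurable_of_isSemialgebraicFunOn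
    (isSemialgebraicFunOn_glit (isSemialgebraic_pDom _ _ _) _ _ _ _ _ _ _ _) hWm) ?_
  filter_upwards [ae_restrict_mem hWm] with z hz
  obtain ⟨hy, ⟨h1, -⟩, -⟩ := (hmemW z).1 hz
  obtain ⟨hm0, hmP, -⟩ := hPQ _ hy
  have hd : mlo ≤ tv z i - ev c (yv z) := by linarith
  have hdpos : 0 < tv z i - ev c (yv z) := lt_of_lt_of_le hm0 hd
  rw [Real.norm_eq_abs, Real.norm_eq_abs, hfF z, abs_mul, abs_of_pos (one_div_pos.2 hdpos), mul_comm]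
  exact mul_le_mul_of_nonneg_right (one_div_le_one_div_of_le hm0 hd) (abs_nonneg _)

/-! ### The Janus extensions of one fibre -/

/-- Slope of a level parallel to the letter. [folklore] -/
theorem add_mk_zero_fst (c : Cf) (K : ℚ) : (c + mk 0 K).1 (Fin.last 0) = c.1 (Fin.last 0) := by
  rw [add_fst, mk_fst, add_zero]

/-- Value of a level parallel to the letter. [folklore] -/
theorem ev_add_mk_zero (c : Cf) (K : ℚ) (y : ℝ) : ev (c + mk 0 K) y = ev c y + K := by
  rw [ev_add, ev_mk, Rat.cast_zero, zero_mul, zero_add]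

/-- **Janus extension upwards** of the fibre `i` of a product representation: `D = {Uᵢ < tᵢ < Vᵢ}`
above its letter `c`, under a level `c + K` with `Vᵢ ≤ c + K`, `Vᵢ − c ≥ m > 0` and
`c + K − Vᵢ ≤ λ (Vᵢ − Uᵢ)` on the base cell, extends to `T = {Uᵢ < tᵢ < c + K}` by the wedge
`W = {Vᵢ < tᵢ < c + K}`: both are product representations and `[T] − [D] − [W] ∈ KZ.relations`. -/
theorem janus_up {s : KZ.IntegralRep (0 + 1 + k)} {m' : ℕ} {M : Fin m' → Cf} {U V : Fin k → Cf}
    {T : BData} {p : MvPolynomial (Fin 0) ℚ} {a : Fin k → Option Cf} (h : IsProd s M U V T p a)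
    (i : Fin k) (c : Cf) (ha : a i = some c) (K : ℚ) (lam mlo : ℝ) (hlam : 0 < lam)
    (hI : ∀ y ∈ cell M, ev (U i) y < ev (V i) y ∧ ev (V i) y ≤ ev c y + K ∧ 0 < mlo ∧
      mlo ≤ ev (V i) y - ev c y ∧ ev c y + K - ev (V i) y ≤ lam * (ev (V i) y - ev (U i) y)) :
    ∃ sT sW : KZ.IntegralRep (0 + 1 + k), IsProd sT M U (Function.update V i (c + mk 0 K)) T p a ∧
      IsProd sW M (Function.update U i (V i)) (Function.update V i (c + mk 0 K)) T p a ∧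
      KZ.of sT - KZ.of s - KZ.of sW ∈ KZ.relations := by
  obtain ⟨R, hR⟩ := h.cbd
  have hW : IntegrableOn (glitB T p a) (pDom M (Function.update U i (V i))
      (Function.update V i (c + mk 0 K))) :=
    integrableOn_wedge h i c ha (V i) (c + mk 0 K) lam mlo hlam fun y hy => by
      obtain ⟨-, -, hm0, hmV, hlen⟩ := hI y hy
      exact ⟨hm0, hmV, by rw [ev_add_mk_zero]; exact hlen⟩
  obtain ⟨sT, sW, hTd, hTi, -, hWd, hWi, -, hrel⟩ := janusExtendHi s M (fun j => Sum.inr (U j))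
    (fun j => Sum.inr (V j)) h.dom T.L T.e p T.ℓ₁ T.ℓ₂ T.n₁ T.n₂ a h.int i (V i) (c + mk 0 K) rfl
    (fun z hz => by
      rw [affF_eq, affF_eq, ev_add_mk_zero]
      exact (hI _ (fun j => by rw [← affF_eq]; exact hz j)).2.1)
    (fun z hz => by
      rw [update_inr, update_inr] at hz
      rw [pv_inr, affF_eq]
      exact (hI _ ((mem_pDom _ _ _ z).1 hz).1).1.le)
    (by rw [update_inr, update_inr]; exact hW)
    (by rw [update_inr]; exact isBounded_pDom _ _ _ hR)
  rw [update_inr] at hTd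
  rw [update_inr, update_inr] at hWd
  exact ⟨sT, sW, ⟨hTd, fun z _ => by rw [hTi]; rfl, h.adm, R, hR⟩,
    ⟨hWd, fun z _ => by rw [hWi]; rfl, h.adm, R, hR⟩, hrel⟩

/-- **Janus extension downwards** of the fibre `i`: `D = {Uᵢ < tᵢ < Vᵢ}` above a level `c + K`
(`K > 0`, `c + K ≤ Uᵢ`) with `Uᵢ − c − K ≤ λ (Vᵢ − Uᵢ)` on the base cell extends to
`T = {c + K < tᵢ < Vᵢ}` by the wedge `W = {c + K < tᵢ < Uᵢ}`. -/
theorem janus_down {s : KZ.IntegralRep (0 + 1 + k)} {m' : ℕ} {M : Fin m' → Cf} {U V : Fin k → Cf}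
    {T : BData} {p : MvPolynomial (Fin 0) ℚ} {a : Fin k → Option Cf} (h : IsProd s M U V T p a)
    (i : Fin k) (c : Cf) (ha : a i = some c) (K : ℚ) (lam : ℝ) (hlam : 0 < lam) (hK : 0 < K)
    (hI : ∀ y ∈ cell M, ev (U i) y < ev (V i) y ∧ ev c y + K ≤ ev (U i) y ∧
      ev (U i) y - (ev c y + K) ≤ lam * (ev (V i) y - ev (U i) y)) :
    ∃ sT sW : KZ.IntegralRep (0 + 1 + k), IsProd sT M (Function.update U i (c + mk 0 K)) V T p a ∧
      IsProd sW M (Function.update U i (c + mk 0 K)) (Function.update V i (U i)) T p a ∧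
      KZ.of sT - KZ.of s - KZ.of sW ∈ KZ.relations := by
  obtain ⟨R, hR⟩ := h.cbd
  have hW : IntegrableOn (glitB T p a) (pDom M (Function.update U i (c + mk 0 K))
      (Function.update V i (U i))) :=
    integrableOn_wedge h i c ha (c + mk 0 K) (U i) lam K hlam fun y hy => by
      obtain ⟨-, -, hlen⟩ := hI y hy
      exact ⟨by exact_mod_cast hK, by rw [ev_add_mk_zero]; linarith, by rw [ev_add_mk_zero]; exact hlen⟩
  obtain ⟨sT, sW, hTd, hTi, -, hWd, hWi, -, hrel⟩ := janusExtendLo s M (fun j => Sum.inr (U j))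
    (fun j => Sum.inr (V j)) h.dom T.L T.e p T.ℓ₁ T.ℓ₂ T.n₁ T.n₂ a h.int i (U i) (c + mk 0 K) rfl
    (fun z hz => by
      rw [affF_eq, affF_eq, ev_add_mk_zero]
      exact (hI _ (fun j => by rw [← affF_eq]; exact hz j)).2.1)
    (fun z hz => by
      rw [update_inr, update_inr] at hz
      rw [pv_inr, affF_eq]
      exact (hI _ ((mem_pDom _ _ _ z).1 hz).1).1.le)
    (by rw [update_inr, update_inr]; exact hW)
    (by rw [update_inr]; exact isBounded_pDom _ _ _ hR)
  rw [update_inr] at hTd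
  rw [update_inr, update_inr] at hWd
  exact ⟨sT, sW, ⟨hTd, fun z _ => by rw [hTi]; rfl, h.adm, R, hR⟩,
    ⟨hWd, fun z _ => by rw [hWi]; rfl, h.adm, R, hR⟩, hrel⟩

end RebaseZero

/-- Registered support goal of this file: absolute convergence of the literal integrand on a
Janus wedge of one fibre of a product representation (`RebaseZero.integrableOn_wedge`). -/
theorem rebaseSimpleZeroProduct_wedge (k m' : ℕ) (s : KZ.IntegralRep (0 + 1 + k)) (M : Fin m' → (Fin (0 + 1) → ℚ) × ℚ) (U V : Fin k → (Fin (0 + 1) → ℚ) × ℚ) (T : RebaseZero.BData) (p : MvPolynomial (Fin 0) ℚ) (a : Fin k → Option ((Fin (0 + 1) → ℚ) × ℚ)) (h : RebaseZero.IsProd s M U V T p a) (i : Fin k) (c : (Fin (0 + 1) → ℚ) × ℚ) (ha : a i = some c) (P Q : (Fin (0 + 1) → ℚ) × ℚ) (lam mlo : ℝ) (hlam : 0 < lam) (hPQ : ∀ y ∈ RebaseZero.cell M, 0 < mlo ∧ mlo ≤ RebaseZero.ev P y - RebaseZero.ev c y ∧ RebaseZero.ev Q y - RebaseZero.ev P y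 ≤ lam * (RebaseZero.ev (V i) y - RebaseZero.ev (U i) y)) : IntegrableOn (RebaseZero.glitB T p a) (RebaseZero.pDom M (Function.update U i P) (Function.update V i Q)) :=
  RebaseZero.integrableOn_wedge h i c ha P Q lam mlo hlam hPQ

end Summit.KontsevichZagierPeriods.ArrangementNormalForm.JanusBands
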